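import Literature.NumberTheory.Congruences.WolstenholmePrimePower
import Literature.NumberTheory.Congruences.LeudesdorfTheorem
import Mathlib.NumberTheory.Padics.PadicVal.Basic
import Mathlib.Data.Nat.Factorization.Basic
import Mathlib.Data.Nat.Choose.Basic
import Mathlib.Tactic
import HarnessLib

/-!
# The block congruence `∏_{t(p^a)} (px + t) ≡ ∏_{t(p^a)} t (mod p^{a+2} ℤ[x])` (`p ≥ 5`) — towards Jacobsthal's binomial congruence

Topic `Literature/NumberTheory/Congruences`, namespace `Literature.NumberTheory.Congruences.Jacobsthal`
(files `JacobsthalBlockCongruence` → `JacobsthalBlockPolynomial` → `JacobsthalBinomialCongruence`).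
Everything here is PROVED (theorems only; no definitions, no named facts). HONEST FRAMING (cell
pub-zeta5, D2 lens): a classical `p`-adic congruence for binomial coefficients and its polynomial
mechanism; nothing here concerns `ζ(5)` or any irrationality statement.

The target of the three files is JACOBSTHAL'S CONGRUENCE as printed in
R. Meštrović, *Wolstenholme's theorem: its generalizations and extensions in the last hundred and fifty
years (1862–2012)*, arXiv:1111.3057, §6 (held; `lit read arxiv:1111.3057`, p. 8), VERBATIM:

> «Further, the congruence (33) is refined in 1952 by E. Jacobsthal ([bs]; also see [gr] and [co]) as
> follows: if `p ≥ 5` is a prime, `n` and `m` are positive integers with `m ≤ n`, then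
> (34) `C(np, mp) ≡ C(n, m) (mod p^t)`, where `t` is the power of `p` dividing `p³nm(n−m)` (this
> exponent `t` can only be increased if `p` divides `B_{p−3}`, the `(p−3)`rd Bernoulli number).
> Remark 15. In the literature, the congruence (34) is often called Jacobsthal-Kazandzidis congruence.
> In particular, the congruence (34) implies that for all nonnegative integers `n, m, a, b` and `c` with
> `c ≤ b ≤ a`, and any prime `p ≥ 5` (35) `C(np^a, mp^b) ≡ C(np^{a−c}, mp^{b−c}) (mod p^{3+a+2b−3c})`.
> Moreover, taking `a = b` and `c = 1` into (35) … we find that for any prime `p ≥ 5`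
> (36) `C(np^a, mp^a) ≡ C(np^{a−1}, mp^{a−1}) (mod p^{3a})`. …
> Remark 17. It is pointed out in [ht] that for a prime `p ≥ 5` using `p`-adic methods, the modulus
> `p^s` in the congruence (37) can be improved to `p^f`, where `f` is the power of `p` dividing
> `p³mn(n−m)C(n,m)`.»

and, in the ratio form used for the Apéry-number supercongruences, A. Straub, *Multivariate Apéry numbers
and supercongruences of rational functions*, Algebra & Number Theory **8** (2014), §5 (held;
`lit read arxiv:1401.0854`, p. 11), VERBATIM:

> «Lemma 5.1. For all primes `p` and all integers `a, b`, (41) `C(ap, bp)/C(a, b) ≡ ε (mod p^q)`, where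
> `q` is the power of `p` dividing `p³ab(a−b)/12` and where `ε = 1`, unless `p = 2` and
> `(a, b) ≡ (0, 1)` modulo `2` in which case `ε = −1`. Proof. Congruence (41), for nonnegative `a, b`, is
> proved in [gessel-euler] …»

(For `p ≥ 5` the factor `1/12` is a unit, so `q = 3 + v_p(a) + v_p(b) + v_p(a−b)`.) The tree has the
case `q = 3` (Ljunggren, `Ljunggren.choose_mul_prime`) and its refinements modulo `p⁴`, `p⁵`; the
`MultivariateAperySupercongruenceProofs` file records that Straub's uniform-in-`r` proof of the prime-power
supercongruences «needs Jacobsthal's congruence modulo `p^{r+s+min(r,s)}`, which the tree does not have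
beyond `p³`» — these files supply it.

## Route (this seat's; NOT the printed `p`-adic proofs — Kazandzidis / Robert–Zuber via Morita's `Γ_p`)

With `c = a − b`, the exact identity `C(ap, bp) · ∏_{0<i<cp, p∤i} i = C(a, b) · ∏_{0<i<cp, p∤i} (bp + i)`
reduces Jacobsthal's congruence to a statement about the integer polynomial
`E_c(x) = ∏_{0<i<cp, p∤i} (px + i)`: namely `E_c(x) − E_c(0) ∈ p^{3+v_p(c)} · x (x + c) · ℤ[x]`
(file `JacobsthalBlockPolynomial`), evaluated at `x = b`. THIS file proves the one-block case of the
coefficient estimate, for the reduced residues `t(p^a)` modulo a prime power: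

**`∏_{t ∈ t(p^a)} (px + t) ≡ ∏_{t ∈ t(p^a)} t (mod p^{a+2} ℤ[x])`** (`p ≥ 5`, `a ≥ 1`;
`exists_prod_C_mul_X_add_C_eq`) — the tree's Glaisher block congruence
`(px + 1)(px + 2)⋯(px + p − 1) ≡ (p − 1)! (mod p³ ℤ[x])` (`Ljunggren.block_congruence_X`) is the case
`a = 1`. Writing `f(x) = ∏_{t(p^a)} (x − t) = Σ_k A_k x^k` (so that `∏ (px + t) = f(−px)`, `#t(p^a)`
being even), the claim is `p^{a+2} ∣ p^k A_k` for every `k ≥ 1`: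
* `k = 1`: `A_1 = ± S_{p^a} Π t` and LEUDESDORF's theorem (Hardy–Wright Thm 128, tree
  `Leudesdorf.leudesdorf`) gives `p^{2a} ∣ A_1` (`pow_two_mul_dvd_coeff_one`);
* `k ≥ 2`: BAUER's identical congruence `f(x) ≡ (x^{p−1} − 1)^{p^{a−1}} (mod p^a)` (Hardy–Wright Thm 126,
  tree `BauerWolstenholme.exists_sub_pow_eq_C_mul`): if `(p−1) ∤ k` then `p^a ∣ A_k`; if `k = (p−1)t` then
  `A_k ≡ ± C(p^{a−1}, t) (mod p^a)` with `p^{a−1−v_p(t)} ∣ C(p^{a−1}, t)` (from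
  `t C(p^{a−1}, t) = p^{a−1} C(p^{a−1} − 1, t − 1)`) and `k = (p−1)t ≥ 4t ≥ 3 + v_p(t)`
  (`pow_dvd_pow_mul_coeff`). This is where `p ≥ 5` enters (for `p = 3`, `t = 1` fails, as does (34)).

## References

* [Mestrovic2011] R. Meštrović, *Wolstenholme's theorem: its generalizations and extensions in the last
  hundred and fifty years (1862–2012)*, arXiv:1111.3057 (2011), §6 (34)–(36), Remarks 15–17.
* [Straub2014] A. Straub, *Multivariate Apéry numbers and supercongruences of rational functions*,
  Algebra & Number Theory 8 (2014) 1985–2008, Lemma 5.1.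
* [HardyWright2008] G. H. Hardy, E. M. Wright, *An Introduction to the Theory of Numbers*, 6th ed.
  (2008), Theorems 126 (Bauer), 128 (Leudesdorf), 130 — the tree's `BauerIdenticalCongruence`,
  `LeudesdorfTheorem`, `WolstenholmePrimePower`.
* E. Jacobsthal, in: V. Brun, T. Stubban, J. E. Fjeldstad, L. Tambs Lyche, K. E. Aubert, W. Ljunggren,
  E. Jacobsthal, *On the divisibility of the difference between two binomial coefficients*, Den 11te
  Skandinaviske Matematikerkongress, Trondheim (1949), 42–54 — as cited in [Mestrovic2011] ([bs]); not held.
-/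

noncomputable section

open Polynomial Finset
open scoped Nat

namespace Literature.NumberTheory.Congruences.Jacobsthal

/-! ### §1. Polynomial helpers -/

/-- Coefficients of `f(cX)`: `[X^k] f(cX) = c^k [X^k] f`. [folklore] -/
private theorem coeff_comp_C_mul_X {R : Type*} [CommSemiring R] (f : R[X]) (c : R) (k : ℕ) :
    (f.comp (C c * X)).coeff k = c ^ k * f.coeff k := by
  induction f using Polynomial.induction_on' with
  | add f g hf hg => rw [add_comp, coeff_add, coeff_add, hf, hg, mul_add]
  | monomial n a =>
    rw [← C_mul_X_pow_eq_monomial, mul_comp, C_comp, X_pow_comp, mul_pow, ← C_pow, ← mul_assoc,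
      ← C_mul, coeff_C_mul_X_pow, coeff_C_mul_X_pow]
    split_ifs with h
    · subst h; ring
    · rw [mul_zero]

/-- A polynomial in `X^q` has no coefficient in a degree not divisible by `q`: here `(X^q − 1)^N`.
[folklore] -/
private theorem coeff_X_pow_sub_one_pow_eq_zero {R : Type*} [CommRing R] {q : ℕ} (hq : 0 < q) (N : ℕ)
    {j : ℕ} (hj : ¬ q ∣ j) : (((X : R[X]) ^ q - 1) ^ N).coeff j = 0 := by
  have h : ((X : R[X]) ^ q - 1) ^ N = expand R q ((X - 1) ^ N) := by
    rw [map_pow, map_sub, expand_X, map_one]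
  rw [h, coeff_expand hq, if_neg hj]

/-- The coefficient of `X^{qt}` in `(X^q − 1)^N` is `(−1)^{N−t} C(N, t)`. [folklore] -/
private theorem coeff_X_pow_sub_one_pow_mul {R : Type*} [CommRing R] {q : ℕ} (hq : 0 < q) (N t : ℕ) :
    (((X : R[X]) ^ q - 1) ^ N).coeff (q * t) = (-1) ^ (N - t) * (N.choose t : R) := by
  have h : ((X : R[X]) ^ q - 1) ^ N = expand R q ((X + C (-1)) ^ N) := by
    rw [map_pow, map_add, expand_X, expand_C, C_neg, C_1, ← sub_eq_add_neg]
  rw [h, coeff_expand hq, if_pos (dvd_mul_right q t), Nat.mul_div_cancel_left t hq, coeff_X_add_C_pow]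

/-! ### §2. One block of reduced residues: the coefficients of `f(x) = ∏_{t(p^a)} (x − t)` -/

section Block

variable {p : ℕ} [hp : Fact p.Prime]

/-- The constant coefficient of `∏_{s ∈ E} (x − s)` is `(−1)^{#E} ∏ s`. [folklore] -/
private theorem coeff_zero_prod_X_sub_C (E : Finset ℕ) :
    (∏ s ∈ E, (X - C (s : ℤ))).coeff 0 = (-1) ^ #E * ∏ s ∈ E, (s : ℤ) := by
  rw [coeff_zero_eq_eval_zero, eval_prod]
  simp only [eval_sub, eval_X, eval_C, zero_sub]
  rw [← prod_const, ← prod_mul_distrib]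
  exact prod_congr rfl fun s _ => by ring

/-- **The `x¹` coefficient** of `f(x) = ∏_{t(p^a)} (x − t)` is `± S_{p^a} Π t`, hence divisible by
`p^{2a}` for `p > 3` (Leudesdorf's theorem, Hardy–Wright Thm 128, tree `Leudesdorf.leudesdorf`).
[cite: HardyWright2008, Thm 128 (8.7.1)] -/
theorem pow_two_mul_dvd_coeff_one (h3 : 3 < p) (a : ℕ) :
    (p : ℤ) ^ (2 * a) ∣ (∏ t ∈ {t ∈ range (p ^ a) | (p ^ a).Coprime t}, (X - C (t : ℤ))).coeff 1 := by
  have hp' := hp.out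
  set S := {t ∈ range (p ^ a) | (p ^ a).Coprime t} with hS
  -- `[x¹] f = f′(0) = Σ_t ∏_{s ≠ t} (−s)`
  have h1 : (∏ t ∈ S, (X - C (t : ℤ))).coeff 1 =
      ∑ t ∈ S, (-1) ^ #(S.erase t) * ∏ s ∈ S.erase t, (s : ℤ) := by
    have hd := coeff_derivative (∏ t ∈ S, (X - C (t : ℤ))) 0
    rw [zero_add, Nat.cast_zero, zero_add, mul_one] at hd
    rw [← hd, derivative_prod_finset, finsetSum_coeff]
    refine sum_congr rfl fun t _ => ?_
    rw [derivative_X_sub_C, mul_one, coeff_zero_prod_X_sub_C]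
  -- all the signs are equal
  have h2 : ∑ t ∈ S, (-1) ^ #(S.erase t) * ∏ s ∈ S.erase t, (s : ℤ) =
      (-1) ^ (#S - 1) * ∑ t ∈ S, ∏ s ∈ S.erase t, (s : ℤ) := by
    rw [mul_sum]
    refine sum_congr rfl fun t ht => ?_
    rw [card_erase_of_mem ht]
  rw [h1, h2]
  -- Leudesdorf: `(p^a)² ∣ S_{p^a} Π t`
  have h2a : ¬ 2 ∣ p ^ a := fun h => by
    have := (Nat.prime_dvd_prime_iff_eq Nat.prime_two hp').mp (Nat.prime_two.dvd_of_dvd_pow h)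
    omega
  have h3a : ¬ 3 ∣ p ^ a := fun h => by
    have := (Nat.prime_dvd_prime_iff_eq Nat.prime_three hp').mp (Nat.prime_three.dvd_of_dvd_pow h)
    omega
  have hL := Leudesdorf.leudesdorf (m := p ^ a) h2a h3a
  rw [← hS, ← pow_mul, mul_comm a 2] at hL
  have hLz : ((p ^ (2 * a) : ℕ) : ℤ) ∣ ((∑ t ∈ S, ∏ s ∈ S.erase t, s : ℕ) : ℤ) :=
    Int.natCast_dvd_natCast.mpr hL
  push_cast at hLz
  exact hLz.mul_left _

/-- **The higher coefficients**: for `p > 3`, `a ≥ 1` and `k ≥ 2`, `p^{a+2} ∣ p^k · [x^k] f(x)` with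
`f(x) = ∏_{t(p^a)} (x − t)` — from Bauer's identical congruence `f(x) ≡ (x^{p−1} − 1)^{p^{a−1}}
(mod p^a)` (Hardy–Wright Thm 126, tree `BauerWolstenholme.exists_sub_pow_eq_C_mul`): the binomial
coefficient `[x^{(p−1)t}] (x^{p−1} − 1)^{p^{a−1}} = ± C(p^{a−1}, t)` is divisible by `p^{a−1−v_p(t)}`, and
`(p−1)t ≥ 3 + v_p(t)`. [cite: HardyWright2008, Thm 126 (8.5.4)] -/
theorem pow_dvd_pow_mul_coeff (h3 : 3 < p) {a : ℕ} (ha : 1 ≤ a) {k : ℕ} (hk : 2 ≤ k) :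
    (p : ℤ) ^ (a + 2) ∣
      (p : ℤ) ^ k * (∏ t ∈ {t ∈ range (p ^ a) | (p ^ a).Coprime t}, (X - C (t : ℤ))).coeff k := by
  have hp' := hp.out
  have hp2 : p ≠ 2 := by omega
  have hp5 : 5 ≤ p := by
    by_contra h
    have h4 : p = 4 := by omega
    exact absurd (h4 ▸ hp') (by decide)
  obtain ⟨H, hH⟩ := BauerWolstenholme.exists_sub_pow_eq_C_mul (p := p) hp2 ha
  obtain ⟨a, rfl⟩ : ∃ a', a = a' + 1 := ⟨a - 1, by omega⟩
  rw [Nat.add_sub_cancel] at hH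
  have hf : (∏ t ∈ {t ∈ range (p ^ (a + 1)) | (p ^ (a + 1)).Coprime t}, (X - C (t : ℤ))).coeff k =
      (((X : ℤ[X]) ^ (p - 1) - 1) ^ (p ^ a)).coeff k + (p : ℤ) ^ (a + 1) * H.coeff k := by
    have := congrArg (fun P : ℤ[X] => P.coeff k) hH
    simp only [coeff_sub, coeff_C_mul] at this
    linarith
  rw [hf, mul_add]
  refine dvd_add ?_ ⟨(p : ℤ) ^ (k - 2) * H.coeff k, ?_⟩
  swap
  · rw [← mul_assoc, ← mul_assoc, ← pow_add, ← pow_add, show a + 1 + 2 + (k - 2) = k + (a + 1) by omega]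
  by_cases hdvd : (p - 1) ∣ k
  · -- `k = (p − 1) t`, `t ≥ 1`
    obtain ⟨t, rfl⟩ := hdvd
    have ht : 1 ≤ t := by
      rcases Nat.eq_zero_or_pos t with h0 | h0
      · subst h0; omega
      · exact h0
    rw [coeff_X_pow_sub_one_pow_mul (by omega), ← mul_assoc, mul_comm ((p : ℤ) ^ _), mul_assoc]
    refine Dvd.dvd.mul_left ?_ _
    -- `p^{a+3} ∣ p^{(p−1)t} C(p^a, t)` in `ℕ`
    suffices h : p ^ (a + 1 + 2) ∣ p ^ ((p - 1) * t) * (p ^ a).choose t by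
      have := Int.natCast_dvd_natCast.mpr h
      push_cast at this
      exact this
    set N := p ^ a with hN
    by_cases hC : N.choose t = 0
    · rw [hC, mul_zero]; exact dvd_zero _
    -- `N · C(N − 1, t − 1) = C(N, t) · t`, so `p^a ∣ C(N, t) · t`
    have hid : N * (N - 1).choose (t - 1) = N.choose t * t := by
      have h := Nat.add_one_mul_choose_eq (N - 1) (t - 1)
      have hN1 : 1 ≤ N := Nat.one_le_pow _ _ hp'.pos
      rwa [Nat.sub_add_cancel hN1, Nat.sub_add_cancel ht] at h
    have hNdvd : p ^ a ∣ N.choose t * t := by rw [← hid]; exact Dvd.intro _ rfl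
    have ht0 : t ≠ 0 := by omega
    have hv : a ≤ padicValNat p (N.choose t) + padicValNat p t := by
      rw [← padicValNat.mul hC ht0]
      exact (padicValNat_dvd_iff_le (mul_ne_zero hC ht0)).mp hNdvd
    -- `v_p(t) < t` and `(p − 1) t ≥ 4t`
    have hvt : padicValNat p t < t := by
      have h1 : p ^ padicValNat p t ≤ t := Nat.le_of_dvd (by omega) pow_padicValNat_dvd
      have h2 : padicValNat p t < p ^ padicValNat p t := Nat.lt_pow_self hp'.one_lt
      omega
    have hp4 : 4 * t ≤ (p - 1) * t := Nat.mul_le_mul_right t (show 4 ≤ p - 1 by omega)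
    rw [padicValNat_dvd_iff_le (mul_ne_zero (pow_ne_zero _ hp'.ne_zero) hC), padicValNat.mul
      (pow_ne_zero _ hp'.ne_zero) hC, padicValNat.prime_pow]
    generalize (p - 1) * t = K at hp4 ⊢
    omega
  · rw [coeff_X_pow_sub_one_pow_eq_zero (by omega) _ hdvd, mul_zero]
    exact dvd_zero _

/-- **All coefficients of positive degree**: for `p > 3`, `a ≥ 1`, `k ≥ 1`,
`p^{a+2} ∣ p^k · [x^k] ∏_{t(p^a)} (x − t)`. [cite: HardyWright2008, Thms 126, 128] -/
theorem pow_dvd_pow_mul_coeff_of_pos (h3 : 3 < p) {a : ℕ} (ha : 1 ≤ a) {k : ℕ} (hk : 1 ≤ k) :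
    (p : ℤ) ^ (a + 2) ∣
      (p : ℤ) ^ k * (∏ t ∈ {t ∈ range (p ^ a) | (p ^ a).Coprime t}, (X - C (t : ℤ))).coeff k := by
  rcases Nat.lt_or_ge k 2 with hk2 | hk2
  · have hk1 : k = 1 := by omega
    subst hk1
    rw [pow_one]
    have h := pow_two_mul_dvd_coeff_one (p := p) h3 a
    have hle : (p : ℤ) ^ (a + 2) ∣ (p : ℤ) * (p : ℤ) ^ (2 * a) := by
      rw [← pow_succ']
      exact pow_dvd_pow _ (by omega)
    exact hle.trans (mul_dvd_mul_left _ h)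
  · exact pow_dvd_pow_mul_coeff h3 ha hk2

/-- `#t(p^a) = p^{a−1}(p − 1)` is even (`p` odd, `a ≥ 1`). [folklore] -/
private theorem even_card (hp2 : p ≠ 2) {a : ℕ} (ha : 1 ≤ a) :
    Even #{t ∈ range (p ^ a) | (p ^ a).Coprime t} := by
  have hp' := hp.out
  rw [← Nat.totient_eq_card_coprime, Nat.totient_prime_pow hp' (by omega)]
  refine Even.mul_left ((hp'.even_sub_one) hp2) _

/-- **One block, multiplicatively written**: for `p > 3` and `a ≥ 1`,
`∏_{t ∈ t(p^a)} (p x + t) ≡ ∏_{t ∈ t(p^a)} t (mod p^{a+2} ℤ[x])` — the tree's Glaisher block congruence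
`(px + 1)(px + 2)⋯(px + p − 1) ≡ (p − 1)! (mod p³ ℤ[x])` (`Ljunggren.block_congruence_X`, the case `a = 1`)
one prime power up. [cite: HardyWright2008, Thms 126, 128] -/
theorem exists_prod_C_mul_X_add_C_eq (h3 : 3 < p) {a : ℕ} (ha : 1 ≤ a) :
    ∃ H : ℤ[X], ∏ t ∈ {t ∈ range (p ^ a) | (p ^ a).Coprime t}, (C (p : ℤ) * X + C (t : ℤ)) =
      C (∏ t ∈ {t ∈ range (p ^ a) | (p ^ a).Coprime t}, (t : ℤ)) + C ((p : ℤ) ^ (a + 2)) * H := by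
  have hp' := hp.out
  set S := {t ∈ range (p ^ a) | (p ^ a).Coprime t} with hS
  set f : ℤ[X] := ∏ t ∈ S, (X - C (t : ℤ)) with hf
  -- `∏ (px + t) = f(−px)` since `#S` is even
  have hB : ∏ t ∈ S, (C (p : ℤ) * X + C (t : ℤ)) = f.comp (C (-(p : ℤ)) * X) := by
    rw [hf, Polynomial.prod_comp]
    have : ∀ t ∈ S, (X - C (t : ℤ)).comp (C (-(p : ℤ)) * X) = (-1) * (C (p : ℤ) * X + C (t : ℤ)) := by
      intro t _
      rw [sub_comp, X_comp, C_comp, C_neg]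
      ring
    rw [prod_congr rfl this, prod_mul_distrib, prod_const, (even_card (p := p) (by omega) ha).neg_one_pow,
      one_mul]
  -- every coefficient of positive degree of `f(−px)` is divisible by `p^{a+2}`
  have hdvd : C ((p : ℤ) ^ (a + 2)) ∣ f.comp (C (-(p : ℤ)) * X) - C ((f.comp (C (-(p : ℤ)) * X)).coeff 0) := by
    rw [C_dvd_iff_dvd_coeff]
    intro i
    rw [coeff_sub, coeff_C]
    rcases Nat.eq_zero_or_pos i with h0 | hi
    · subst h0; simp
    · rw [if_neg (by omega), sub_zero, coeff_comp_C_mul_X, neg_pow, mul_assoc, mul_comm ((-1 : ℤ) ^ i)]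
      exact (pow_dvd_pow_mul_coeff_of_pos (p := p) h3 ha hi).mul_right _
  obtain ⟨H, hH⟩ := hdvd
  refine ⟨H, ?_⟩
  have h0 : (f.comp (C (-(p : ℤ)) * X)).coeff 0 = ∏ t ∈ S, (t : ℤ) := by
    rw [← hB, coeff_zero_eq_eval_zero, eval_prod]
    refine prod_congr rfl fun t _ => ?_
    simp
  rw [hB, ← h0]
  linear_combination hH

end Block

end Literature.NumberTheory.Congruences.Jacobsthal

end
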